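import Summits.QuantumFields.YangMills.Theorems.BalabanUVNodesK0RecordFormatNamesLDress
import Summits.QuantumFields.YangMills.Theorems.BalabanUVNodesK0RecordFormatNamesLemmas9
import Summits.QuantumFields.YangMills.Theorems.BalabanUVNodesK0RecordFormatNamesLemmas

/-!
# K0⁷ record FORMAT⁺ names — lemma file 10: faces of EDITION 14b (the dressed chart `recordEmbL`)

Companion of `…K0RecordFormatNamesLDress`.  Kernel-checked bookkeeping; nothing of Bałaban's asserted.  DEFINER seat `ym-nodeO-def-1` (gen 34);
`--kind proof --supports stmt-QuantumFields-20541 --as helper`; count-neutral.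

* §1 by construction: `recordPairL = (recordPairJ)^{u_B}` (`rfl`); `recordEmbJ` reads `recordPairJ` exactly as `recordEmbL` reads `recordPairL` (`rfl`); ★ receipt (E2′)
  `DressedRowAtL` HOLDS (`decode ∘ encode = id`); `recordDdir` at a basis field IS `recordD` (`rfl`).
* §2 at `B = 0`: the response in the direction `0` vanishes, the Landau potential of `0` is `0`, the dressing is the identity transformation, the dressed pair IS the rooted pair,
  hence `recordEmbL … 0 = recordEmbJ … 0` — so (E1′)'s value half is 27931's landed (C2b) (`PortU8IotaRow.recordEmbJ_zero`, porter PT-B).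
* §3 ℝ-linearity in the direction: `recordDdir`, `landauPotC`, `recordPhi` are additive and homogeneous in `B` (from `fderiv`'s linearity and lemma file 9).

HONEST FRAMING.  Bookkeeping; (E4a) `ResponseRowAtL` is NOT proved here; 27931 ⁷‴ not yet signed; K0⁷ NOT closed; NODE O 0∕1; COUNT 8∕28 · K 1∕4 UNMOVED; finite 𝕋⁴ at fixed ε —
not continuum ∕ OS ∕ Clay; the Yang–Mills mass gap is NOT proved by any of this.
-/

noncomputable section

open scoped BigOperators Matrix.Norms.L2Operator

namespace Summit.QuantumFields.YangMills.Theorems.K0RecordFormatNames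

open Literature.MathematicalPhysics.QuantumFieldTheory.Balaban1983to89
open Literature.MathematicalPhysics.QuantumFieldTheory.Balaban1983to89.Node00
open Literature.MathematicalPhysics.QuantumFieldTheory.Balaban1983to89.T4Continuum (T4Family)
open Literature.MathematicalPhysics.QuantumFieldTheory.BalabanImbrieJaffe1984to88.BIJ85AxialPropagator411 (BondSpace)
open NormedSpace (exp)

variable (F : T4Family) (θ : Stage13Params F 2)

/-! ## §1  By construction -/

/-- The dressed pair IS the rooted pair acted on by the dressing (`rfl`). [cite: Balaban1987RG1, (1.10) p.262, (4.2) p.281 (bookkeeping)] -/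
theorem recordPairL_eq (k K : ℕ) (B : Fin (F.P K).d → Site (F.P K) (k + 1) → θ.Vβ) :
    recordPairL F θ k K B = Sect2.cAct (fun x => ((recordDress F θ k K B).1 x : (MatA 2)ˣ)) (recordPairJ F θ k K B) := rfl

/-- `recordEmbJ` reads the rooted pair with the same two-block coordinates `recordEmbL` reads the dressed pair with (`rfl`). [cite: Balaban1987RG1, (1.8)–(1.9) p.261 (bookkeeping)] -/
theorem recordEmbJ_eq_pair (k K : ℕ) (B : Fin (F.P K).d → Site (F.P K) (k + 1) → θ.Vβ) (i : Fin (recordChartDimJ F K)) :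
    recordEmbJ F θ k K B i = Sum.elim
      (fun a => sl2Coord (MatrixLog.mlog ((recordPairJ F θ k K B).1 ((chartEquivJ F K).symm i).1)) a)
      (fun a => sl2Coord ((recordPairJ F θ k K B).2 ((chartEquivJ F K).symm i).1) a)
      ((chartEquivJ F K).symm i).2 := rfl

/-- ★ **RECEIPT (E2′) HOLDS**: the coordinates of the dressed pair are the (1.10) action of the dressing on the coordinates of the rooted pair (`decode ∘ encode = id`).
[cite: Balaban1987RG1, (1.10) p.262, (4.2) p.281] -/
theorem dressedRowAtL_holds (k K : ℕ) : DressedRowAtL F θ k K := fun B => by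
  simp only [recordAct, decodeCfg_encodeCfg]
  rfl

/-- The response in the direction of a basis field IS `recordD` (`rfl`). [cite: Balaban1985Variational, Prop. 9 p.309 (bookkeeping)] -/
theorem recordDdir_single (k K : ℕ) (a : θ.ιβ) (l : RespLabel F k K) :
    letI := θ.instVβ₁; letI := θ.instVβ₂; letI := θ.instιβ
    recordDdir F θ k K (Pi.single l.1 (Pi.single l.2 (θ.bV a))) = recordD F θ k K a l := rfl

/-! ## §2  At `B = 0`: the dressing is trivial and `ι_L(0) = ι_J(0)` -/

/-- The response in the direction `0` vanishes (a derivative is linear). [cite: Balaban1985Variational, Prop. 9 p.309 (bookkeeping)] -/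
theorem recordDdir_zero (k K : ℕ) :
    letI := θ.instVβ₁; letI := θ.instVβ₂
    recordDdir F θ k K 0 = 0 := by
  letI := θ.instVβ₁; letI := θ.instVβ₂
  unfold recordDdir
  exact map_zero _

/-- The complex Landau potential of the zero bond function is zero. [cite: Balaban1984PropagatorsII, (2.12) p.225 (bookkeeping)] -/
theorem landauPotC_zero (k K : ℕ) : landauPotC F k K (fun _ => (0 : ℂ)) = fun _ => 0 := by
  funext y
  have hre : reBond F K (fun _ => (0 : ℂ)) = 0 := by apply WithLp.ofLp_injective 2; funext b; simp [reBond]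
  have him : imBond F K (fun _ => (0 : ℂ)) = 0 := by apply WithLp.ofLp_injective 2; funext b; simp [imBond]
  simp [landauPotC, hre, him, landauPot_zero]

/-- The Landau potential in the direction `0` vanishes. [cite: Balaban1985Variational, (21) p.281 (bookkeeping)] -/
theorem recordPhi_zero (k K : ℕ) (x : Site (F.P K) 0) :
    letI := θ.instVβ₁; letI := θ.instVβ₂
    recordPhi F θ k K 0 x = 0 := by
  letI := θ.instVβ₁; letI := θ.instVβ₂
  unfold recordPhi
  rw [recordDdir_zero]
  have h : (Matrix.of fun i i' : Fin 2 => landauPotC F k K (fun b => (0 : PBond (F.P K) 0 → Fin 2 → Fin 2 → ℂ) b i i') x) = 0 := by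
    ext i i'
    simp only [Matrix.of_apply, Pi.zero_apply, Matrix.zero_apply]
    have := congrFun (landauPotC_zero F k K) x
    simpa using this
  rw [h, map_zero]

/-- The dressing in the direction `0` is the identity transformation. [cite: Balaban1987RG1, (1.10) p.262 (bookkeeping)] -/
theorem recordDress_zero_apply (k K : ℕ) (x : Site (F.P K) 0) :
    letI := θ.instVβ₁; letI := θ.instVβ₂
    ((recordDress F θ k K 0).1 x : (MatA 2)ˣ) = 1 := by
  letI := θ.instVβ₁; letI := θ.instVβ₂
  apply Units.ext
  show exp (recordPhi F θ k K 0 x) = 1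
  rw [recordPhi_zero, NormedSpace.exp_zero]

/-- At `B = 0` the dressed pair IS the rooted pair. [cite: Balaban1987RG1, (4.2) p.281 (bookkeeping)] -/
theorem recordPairL_zero (k K : ℕ) :
    letI := θ.instVβ₁; letI := θ.instVβ₂
    recordPairL F θ k K 0 = recordPairJ F θ k K 0 := by
  letI := θ.instVβ₁; letI := θ.instVβ₂
  rw [recordPairL_eq]
  have h1 : ∀ x, ((recordDress F θ k K 0).1 x : (MatA 2)ˣ) = 1 := recordDress_zero_apply F θ k K
  ext b <;> simp [Sect2.cAct, h1]

/-- ★ At `B = 0` the dressed chart IS the rooted chart: `recordEmbL … 0 = recordEmbJ … 0` — so (E1′)'s value half is the landed (C2b) `PortU8IotaRow.recordEmbJ_zero`.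
[cite: Balaban1987RG1, (4.35) p.290 (bookkeeping)] -/
theorem recordEmbL_zero_eq (k K : ℕ) :
    letI := θ.instVβ₁; letI := θ.instVβ₂
    recordEmbL F θ k K 0 = recordEmbJ F θ k K 0 := by
  letI := θ.instVβ₁; letI := θ.instVβ₂
  funext i
  rw [recordEmbJ_eq_pair, ← recordPairL_zero]
  rfl

/-! ## §3  ℝ-linearity in the direction `B` -/

/-- The response in a direction is additive in the direction. [cite: Balaban1985Variational, Prop. 9 p.309 (bookkeeping)] -/
theorem recordDdir_add (k K : ℕ) (B B' : Fin (F.P K).d → Site (F.P K) (k + 1) → θ.Vβ) :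
    letI := θ.instVβ₁; letI := θ.instVβ₂
    recordDdir F θ k K (B + B') = recordDdir F θ k K B + recordDdir F θ k K B' := by
  letI := θ.instVβ₁; letI := θ.instVβ₂
  unfold recordDdir
  exact map_add _ B B'

/-- The response in a direction is homogeneous in the direction. [cite: Balaban1985Variational, Prop. 9 p.309 (bookkeeping)] -/
theorem recordDdir_smul (k K : ℕ) (t : ℝ) (B : Fin (F.P K).d → Site (F.P K) (k + 1) → θ.Vβ) :
    letI := θ.instVβ₁; letI := θ.instVβ₂
    recordDdir F θ k K (t • B) = t • recordDdir F θ k K B := by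
  letI := θ.instVβ₁; letI := θ.instVβ₂
  unfold recordDdir
  exact map_smul _ t B

/-- The complex Landau potential is additive. [cite: Balaban1984PropagatorsII, (2.12) p.225 (bookkeeping)] -/
theorem landauPotC_add (k K : ℕ) (x y : PBond (F.P K) 0 → ℂ) :
    landauPotC F k K (fun b => x b + y b) = fun s => landauPotC F k K x s + landauPotC F k K y s := by
  funext s
  have hre : reBond F K (fun b => x b + y b) = reBond F K x + reBond F K y := by
    apply WithLp.ofLp_injective 2; funext b; simp [reBond]
  have him : imBond F K (fun b => x b + y b) = imBond F K x + imBond F K y := by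
    apply WithLp.ofLp_injective 2; funext b; simp [imBond]
  simp only [landauPotC, hre, him, landauPot_add, WithLp.ofLp_add, Pi.add_apply]
  push_cast
  ring

/-- The complex Landau potential is ℝ-homogeneous. [cite: Balaban1984PropagatorsII, (2.12) p.225 (bookkeeping)] -/
theorem landauPotC_smul (k K : ℕ) (t : ℝ) (x : PBond (F.P K) 0 → ℂ) :
    landauPotC F k K (fun b => (t : ℂ) * x b) = fun s => (t : ℂ) * landauPotC F k K x s := by
  funext s
  have hre : reBond F K (fun b => (t : ℂ) * x b) = t • reBond F K x := by
    apply WithLp.ofLp_injective 2; funext b; simp [reBond]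
  have him : imBond F K (fun b => (t : ℂ) * x b) = t • imBond F K x := by
    apply WithLp.ofLp_injective 2; funext b; simp [imBond]
  simp only [landauPotC, hre, him, landauPot_smul, WithLp.ofLp_smul, Pi.smul_apply, smul_eq_mul]
  push_cast
  ring

end Summit.QuantumFields.YangMills.Theorems.K0RecordFormatNames

end
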